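import Summits.QuantumAdvantage.QuantumAdvantage.Theorems.CodimDialMediumA

/-! # CodimDialMedium — part 2/2 (mechanical split for landing of `CodimDialMedium`; content verbatim; scopes re-opened with their variables) -/

set_option linter.style.longLine false
set_option linter.dupNamespace false
noncomputable section
open scoped Classical

namespace Summit.QuantumAdvantage.QuantumAdvantage.Theorems.CodimDial
open Finset
open Literature.Computability.QuantumComplexity Literature.Computability.QuantumComplexity.RingHLF
open Literature.Computability.MetaComplexity
open Summit.QuantumAdvantage.AdviceFreeQNC0
open Summit.QuantumAdvantage.QuantumAdvantage.Theses

section Medium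
variable {n : ℕ}

/-- **LinSpreadLogMed3** [UNDECIDED · `⟸ SpreadLoss3` PROVED (`linSpreadLogMed3_of_spreadLoss3`) · `⟸ LinSpreadLog3` ·
`⟹ AlgSpread3` PROVED]: few MEDIUM parities — the dial at logarithmic codimension (`2^ℓ ≤ n^C`) restricted to rows of
weight `≤ n/4` (`4 · rowWeight ≤ n`). -/
def LinSpreadLogMed3 : Prop :=
  ∃ η : ℝ, 0 < η ∧ ∃ k : ℕ, ∀ C c : ℕ, ∃ n₀ : ℕ, ∀ n ≥ n₀, ∀ P : Fin n → Smolensky.CubeFn (ZMod 3) n,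
    (∀ i, P i ∈ Smolensky.lowDeg (ZMod 3) n ((Nat.log 2 n) ^ c)) →
    ∀ N : ℕ, N ≤ n ^ C → ∀ G : Fin N → Smolensky.CubeFn (ZMod 3) n,
      (∀ u, G u ∈ Smolensky.lowDeg (ZMod 3) n ((Nat.log 2 n) ^ c)) →
      ∀ ℓ : ℕ, 2 ^ ℓ ≤ n ^ C → ∀ A : Fin ℓ → Fin N → ZMod 2, ∀ b : Fin ℓ → ZMod 2,
        (∀ r, 4 * rowWeight (A r) ≤ n) →
        (1 - η) * (2 : ℝ) ^ n ≤ ((linEvent G A b).card : ℝ) →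
          1 / (n : ℝ) ^ k * (2 : ℝ) ^ n ≤ ((linEvent G A b ∩ lossSet P).card : ℝ)

/-- **piece A** [NEW · WEAKER than 30910: `linCoverLogMed3_of_pureCover3` · NECESSARY for T: `linCoverLogMed3_of_ringHardOdd` ·
UNDECIDED · IDEA-NEEDED · BARRIER TwoModuliDepthTwo applies · contains g8's located core (one row of weight n/8)]:
`PolyLoss3 → AlgSpread3 → LinSpreadLogMed3` — poly loss against every dense polylog-degree algebraic test ⟹ poly loss
inside every dense system of `O(log n)` parities of `≤ n/4` polylog-degree bits. -/
def LinCoverLogMed3 : Prop := SpreadDial.PolyLoss3 → SpreadDial.AlgSpread3 → LinSpreadLogMed3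

/-- **piece B** (the BRIDGE of the lens) [NEW · WEAKER than 30910: `medBridge3_of_pureCover3` · NECESSARY for T:
`medBridge3_of_ringHardOdd` · UNDECIDED · IDEA-NEEDED (weight-preserving codimension reduction; the unbounded-weight
collapse `linSpread3_iff_linSpreadLog3` is PROVED) · implied by `WeightLift3`]: COLLAPSE AT BOUNDED WEIGHT — spread against
few medium parities ⟹ spread inside the joint win event of polynomially many rings (29064). -/
def MedBridge3 : Prop := LinSpreadLogMed3 → SpreadDial.SpreadLoss3

/-- [aside · UNDECIDED · ⟹ MedBridge3 · necessary for T] the alternative (stronger) bridge: WEIGHT LIFT at logarithmic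
codimension — medium rows ⟹ arbitrary rows. -/
def WeightLift3 : Prop := LinSpreadLogMed3 → LinSpreadLog3

/-- down the weight axis: heavy ⟹ medium. -/
theorem linSpreadLogMed3_of_linSpreadLog3 (h : LinSpreadLog3) : LinSpreadLogMed3 := by
  obtain ⟨η, hη, k, hk⟩ := h
  refine ⟨η, hη, k, fun C c => ?_⟩
  obtain ⟨n₀, hn₀⟩ := hk C c
  exact ⟨n₀, fun n hn P hP N hN G hG ℓ hℓ A b _ hd => hn₀ n hn P hP N hN G hG ℓ hℓ A b hd⟩

/-- the medium dial already contains one algebraic test: `LinSpreadLogMed3 → AlgSpread3` (one row of weight one). -/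
theorem algSpread3_of_linSpreadLogMed3 (h : LinSpreadLogMed3) : SpreadDial.AlgSpread3 := by
  obtain ⟨η, hη, k, hk⟩ := h
  refine ⟨η, hη, k, fun c => ?_⟩
  obtain ⟨n₀, hn₀⟩ := hk 1 c
  refine ⟨max n₀ 4, fun n hn P hP ψ hψ hdense => ?_⟩
  have hnn₀ : n₀ ≤ n := le_of_max_le_left hn
  have hn4 : 4 ≤ n := le_of_max_le_right hn
  let G : Fin 1 → Smolensky.CubeFn (ZMod 3) n := fun _ => ψ
  let A : Fin 1 → Fin 1 → ZMod 2 := fun _ _ => 1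
  let b : Fin 1 → ZMod 2 := fun _ => 1
  have hkey : ∀ y, y ∈ linEvent G A b ↔ ψ y = 1 := by
    intro y
    simp only [linEvent, Finset.mem_filter, Finset.mem_univ, true_and, defect, A, b, G,
      Finset.univ_unique, Finset.sum_singleton, one_mul]
    constructor
    · intro h
      have h0 := h 0
      by_contra hne
      simp [bit, hne] at h0
    · intro h r
      simp only [bit, h, if_true]
      decide
  have hW : ∀ r, 4 * rowWeight (A r) ≤ n := by
    intro r
    have : rowWeight (A r) ≤ 1 := le_trans (Finset.card_le_univ _) (by simp)
    omega
  have hdense' : (1 - η) * (2 : ℝ) ^ n ≤ ((linEvent G A b).card : ℝ) := by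
    refine le_trans hdense ?_
    exact_mod_cast card_le_card fun y hy => by
      simp only [Finset.mem_filter, Finset.mem_univ, true_and] at hy
      exact (hkey y).mpr hy
  have hmain := hn₀ n hnn₀ P hP 1 (by simpa using Nat.one_le_pow 1 n (by omega)) G (fun _ => hψ) 1
    (by simpa using show 2 ≤ n by omega) A b hW hdense'
  refine le_trans hmain ?_
  exact_mod_cast card_le_card fun y hy => by
    rw [Finset.mem_inter] at hy
    simp only [lossSet, Finset.mem_filter, Finset.mem_univ, true_and] at hy
    simp only [Finset.mem_filter, Finset.mem_univ, true_and]
    exact ⟨(hkey y).mp hy.1, hy.2⟩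

/-- **THE REALISATION THEOREM**: `SpreadLoss3 (29064) → LinSpreadLogMed3` — a system of `ℓ = O(log n)` rows of
weight `≤ n/4` on polylog-degree bits is, input for input, the joint win event of `ℓ` host rings with the all-`X`
pattern (§9), to which 29064 applies. -/
theorem linSpreadLogMed3_of_spreadLoss3 (h : SpreadDial.SpreadLoss3) : LinSpreadLogMed3 := by
  obtain ⟨η, hη, k, hk⟩ := h
  refine ⟨min η (1 / 2), lt_min hη (by norm_num), k + 1, fun C c => ?_⟩
  obtain ⟨n₀, hn₀⟩ := hk c
  refine ⟨max n₀ (2 ^ (4 * C + 4)), fun n hn P hP N hN G hG ℓ hℓ A b hW hdense => ?_⟩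
  have hnn₀ : n₀ ≤ n := le_of_max_le_left hn
  have hnpow : 2 ^ (4 * C + 4) ≤ n := le_of_max_le_right hn
  have hn4 : 4 ≤ n := le_trans (by
    calc 4 = 2 ^ 2 := by norm_num
      _ ≤ 2 ^ (4 * C + 4) := Nat.pow_le_pow_right (by norm_num) (by omega)) hnpow
  have hL : 4 * C + 4 ≤ Nat.log 2 n := Nat.le_log_of_pow_le (by norm_num) hnpow
  have hηle : min η (1 / 2) ≤ η := min_le_left _ _
  have hη2 : min η (1 / 2) ≤ 1 / 2 := min_le_right _ _
  have hnR : (0 : ℝ) < n := by exact_mod_cast (show 0 < n by omega)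
  have h2n : (0 : ℝ) < (2 : ℝ) ^ n := by positivity
  -- the target exponent `k+1` is below both `k` and `1`
  have hexp : 1 / (n : ℝ) ^ (k + 1) ≤ 1 / (n : ℝ) ^ k := by
    apply one_div_le_one_div_of_le (by positivity)
    rw [pow_succ]
    exact le_mul_of_one_le_right (by positivity) (by exact_mod_cast (show 1 ≤ n by omega))
  have hexp1 : 1 / (n : ℝ) ^ (k + 1) ≤ 1 / 2 := by
    rw [div_le_div_iff₀ (by positivity) (by norm_num), one_mul, one_mul]
    calc (2 : ℝ) ≤ n := by exact_mod_cast (show 2 ≤ n by omega)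
      _ = (n : ℝ) ^ 1 := (pow_one _).symm
      _ ≤ (n : ℝ) ^ (k + 1) := pow_le_pow_right₀ (by exact_mod_cast (show 1 ≤ n by omega)) (by omega)
  rcases Nat.eq_zero_or_pos k with hk0 | hkpos
  · -- k = 0: 29064 with NO rings says every input loses; then the dense event is all loss
    subst hk0
    have hbody := hn₀ n hnn₀ P hP 0 (Nat.zero_le _) (fun _ _ => false) (fun _ _ => 0)
      (fun _ _ => Submodule.zero_mem _)
    have hd0 : (1 - η) * (2 : ℝ) ^ n ≤ ((univ.filter fun y : Fin n → Bool =>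
        ∀ t : Fin 0, RingHLF.Rel ((fun _ _ => false : Fin 0 → Fin n → Bool) t)
          (fun i => decide ((fun _ _ => (0 : Smolensky.CubeFn (ZMod 3) n) : Fin 0 → Fin n → _) t i y = 1))).card : ℝ) := by
      have hall : (univ.filter fun y : Fin n → Bool =>
        ∀ t : Fin 0, RingHLF.Rel ((fun _ _ => false : Fin 0 → Fin n → Bool) t)
          (fun i => decide ((fun _ _ => (0 : Smolensky.CubeFn (ZMod 3) n) : Fin 0 → Fin n → _) t i y = 1))) = univ :=
        Finset.filter_true_of_mem fun y _ t => Fin.elim0 t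
      rw [hall, Finset.card_univ, Fintype.card_fun, Fintype.card_bool, Fintype.card_fin]
      push_cast
      nlinarith
    have hloss := hbody hd0
    -- every input loses
    have hL2 : (2 : ℝ) ^ n ≤ ((lossSet P).card : ℝ) := by
      rw [pow_zero, div_one, one_mul] at hloss
      refine le_trans hloss ?_
      exact_mod_cast card_le_card fun y hy => by
        simp only [Finset.mem_filter, Finset.mem_univ, true_and] at hy
        simp only [lossSet, Finset.mem_filter, Finset.mem_univ, true_and]
        exact hy.2
    have hunion : ((linEvent G A b ∪ lossSet P).card : ℝ) ≤ (2 : ℝ) ^ n := by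
      have := Finset.card_le_univ (linEvent G A b ∪ lossSet P)
      rw [Fintype.card_fun, Fintype.card_bool, Fintype.card_fin] at this
      exact_mod_cast this
    have hie := Finset.card_union_add_card_inter (linEvent G A b) (lossSet P)
    have hie' : ((linEvent G A b ∪ lossSet P).card : ℝ) + ((linEvent G A b ∩ lossSet P).card : ℝ) =
        ((linEvent G A b).card : ℝ) + ((lossSet P).card : ℝ) := by exact_mod_cast hie
    calc 1 / (n : ℝ) ^ (0 + 1) * (2 : ℝ) ^ n ≤ 1 / 2 * (2 : ℝ) ^ n := mul_le_mul_of_nonneg_right hexp1 h2n.le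
      _ ≤ (1 - min η (1 / 2)) * (2 : ℝ) ^ n := mul_le_mul_of_nonneg_right (by linarith) h2n.le
      _ ≤ ((linEvent G A b).card : ℝ) := hdense
      _ ≤ _ := by linarith
  · -- k ≥ 1: realise the system by `ℓ ≤ n ≤ n^k` host rings
    have hℓn : ℓ ≤ n ^ k := le_trans (rows_le_self hL hℓ) (by
      calc n = n ^ 1 := (pow_one n).symm
        _ ≤ n ^ k := Nat.pow_le_pow_right (by omega) hkpos)
    have hWr : ∀ r, 2 * (rowSupp (A r)).card + 1 < n := by
      intro r
      have := hW r
      show 2 * rowWeight (A r) + 1 < n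
      omega
    let Q : Fin ℓ → Fin n → Smolensky.CubeFn (ZMod 3) n := fun r => hostQ G (A r) (b r)
    have hQ : ∀ r s, Q r s ∈ Smolensky.lowDeg (ZMod 3) n ((Nat.log 2 n) ^ c) :=
      fun r s => hostQ_mem_lowDeg G hG (A r) (b r) s
    have hkey : ∀ y, (∀ r, RingHLF.Rel (zeroIn n) (fun s => decide (Q r s y = 1))) ↔ y ∈ linEvent G A b := by
      intro y
      simp only [linEvent, Finset.mem_filter, Finset.mem_univ, true_and]
      exact forall_congr' fun r => host_rel_iff (by omega) G (A r) (b r) (hWr r) y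
    have hdense' : (1 - η) * (2 : ℝ) ^ n ≤ ((univ.filter fun y : Fin n → Bool =>
        ∀ r, RingHLF.Rel ((fun _ => zeroIn n : Fin ℓ → Fin n → Bool) r) (fun s => decide (Q r s y = 1))).card : ℝ) := by
      have h1 : (1 - η) * (2 : ℝ) ^ n ≤ (1 - min η (1 / 2)) * (2 : ℝ) ^ n :=
        mul_le_mul_of_nonneg_right (by linarith) h2n.le
      refine le_trans h1 (le_trans hdense ?_)
      exact_mod_cast card_le_card fun y hy => by
        simp only [Finset.mem_filter, Finset.mem_univ, true_and]
        exact (hkey y).mpr hy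
    have hmain := hn₀ n hnn₀ P hP ℓ hℓn (fun _ => zeroIn n) Q hQ hdense'
    calc 1 / (n : ℝ) ^ (k + 1) * (2 : ℝ) ^ n ≤ 1 / (n : ℝ) ^ k * (2 : ℝ) ^ n :=
          mul_le_mul_of_nonneg_right hexp h2n.le
      _ ≤ _ := hmain
      _ ≤ ((linEvent G A b ∩ lossSet P).card : ℝ) := by
        exact_mod_cast card_le_card fun y hy => by
          simp only [Finset.mem_filter, Finset.mem_univ, true_and] at hy
          rw [Finset.mem_inter]
          refine ⟨(hkey y).mp hy.1, ?_⟩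
          simp only [lossSet, Finset.mem_filter, Finset.mem_univ, true_and]
          exact hy.2

/-- **30910 ⟹ piece A**: `PureCover3 → LinCoverLogMed3`. -/
theorem linCoverLogMed3_of_pureCover3 (h : SpreadDial.PureCover3) : LinCoverLogMed3 :=
  fun hP hA => linSpreadLogMed3_of_spreadLoss3 (h hP hA)

/-- **30910 ⟹ piece B**: `PureCover3 → MedBridge3` (the medium dial supplies 30910's own hypotheses). -/
theorem medBridge3_of_pureCover3 (h : SpreadDial.PureCover3) : MedBridge3 := fun hMed =>
  h (Theorems.SteerDial.polyLoss3_of_algSpread3_item (algSpread3_of_linSpreadLogMed3 hMed))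
    (algSpread3_of_linSpreadLogMed3 hMed)

/-- pieces A and B give 30910 back. -/
theorem pureCover3_of_medPieces (hA : LinCoverLogMed3) (hB : MedBridge3) : SpreadDial.PureCover3 :=
  fun hP hAlg => hB (hA hP hAlg)

/-- ★ **THE CONJUNCT SPLIT OF THE RESIDUAL 30910**: `PureCover3 ⟺ LinCoverLogMed3 ∧ MedBridge3`. -/
theorem pureCover3_iff_medPieces : SpreadDial.PureCover3 ↔ (LinCoverLogMed3 ∧ MedBridge3) :=
  ⟨fun h => ⟨linCoverLogMed3_of_pureCover3 h, medBridge3_of_pureCover3 h⟩, fun h => pureCover3_of_medPieces h.1 h.2⟩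

/-- hence also `CoverLift3 (29065) ⟺ AlgCover3 ∧ LinCoverLogMed3 ∧ MedBridge3`. -/
theorem coverLift3_iff_medPieces :
    SpreadDial.CoverLift3 ↔ (SpreadDial.AlgCover3 ∧ LinCoverLogMed3 ∧ MedBridge3) := by
  rw [Theorems.SteerDial.coverLift3_iff_pieces, pureCover3_iff_medPieces]

/-- the weight lift is the stronger bridge. -/
theorem medBridge3_of_weightLift3 (h : WeightLift3) : MedBridge3 :=
  fun hMed => spreadLoss3_of_linSpreadLog3 (h hMed)

/-- the top of the dial gives both pieces: `LinCoverLog3 → LinCoverLogMed3`, `LinSpreadLog3 → MedBridge3`-conclusion. -/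
theorem linCoverLogMed3_of_linCoverLog3 (h : LinCoverLog3) : LinCoverLogMed3 :=
  fun hP hA => linSpreadLogMed3_of_linSpreadLog3 (h hP hA)

/-- necessity of both pieces for T. -/
theorem linSpreadLogMed3_of_ringHardOdd (h : RingHardOdd 3) : LinSpreadLogMed3 :=
  linSpreadLogMed3_of_linSpreadLog3 (linSpreadLog3_of_ringHardOdd h)

/-- CodimDialMedium helper `linCoverLogMed3_of_ringHardOdd` (decomp-qadv land package; see the module docstring). -/
theorem linCoverLogMed3_of_ringHardOdd (h : RingHardOdd 3) : LinCoverLogMed3 :=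
  fun _ _ => linSpreadLogMed3_of_ringHardOdd h

/-- CodimDialMedium helper `medBridge3_of_ringHardOdd` (decomp-qadv land package; see the module docstring). -/
theorem medBridge3_of_ringHardOdd (h : RingHardOdd 3) : MedBridge3 :=
  fun _ => spreadLoss3_of_linSpread3 (linSpread3_of_ringHardOdd h)

/-- CodimDialMedium helper `weightLift3_of_ringHardOdd` (decomp-qadv land package; see the module docstring). -/
theorem weightLift3_of_ringHardOdd (h : RingHardOdd 3) : WeightLift3 :=
  fun _ => linSpreadLog3_of_ringHardOdd h

/-- ★ **THE DECIDING THEOREM OF THE NODE, four pieces** (conclusion = the rung leaf BY NAME):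
`PolyLoss3 → AlgCover3 → LinCoverLogMed3 → MedBridge3 → AdviceFreeQNC0Three`. -/
theorem closes₄ (hP : SpreadDial.PolyLoss3) (hAlg : SpreadDial.AlgCover3) (hA : LinCoverLogMed3)
    (hB : MedBridge3) : AdviceFreeQNC0Three :=
  Theorems.spreadDial_closes₂ hP (coverLift3_iff_medPieces.mpr ⟨hAlg, hA, hB⟩)

/-- T* from the four pieces. -/
theorem multiRingHard3_of_medPieces (hP : SpreadDial.PolyLoss3) (hAlg : SpreadDial.AlgCover3)
    (hA : LinCoverLogMed3) (hB : MedBridge3) : SpreadDial.MultiRingHard3 :=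
  Theorems.spreadDial_spreadBridge3 (coverLift3_iff_medPieces.mpr ⟨hAlg, hA, hB⟩ hP)

end Medium

end Summit.QuantumAdvantage.QuantumAdvantage.Theorems.CodimDial
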